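import Summits.KontsevichZagierPeriods.KontsevichZagierPeriods.Theorems.IsogenyCertificatesXMapPeriodTransferCellsBasic
import Summits.KontsevichZagierPeriods.KontsevichZagierPeriods.Theorems.XMapPeriodTransfer.Negative.ValueEqLoadBearing
import Literature.NumberTheory.Transcendental.KZLogCalculusProofs
import Literature.NumberTheory.Transcendental.KZSemiCanonicalReductionProofs

/-!
# `XMapPeriodTransfer` (stmt-KontsevichZagierPeriods-10665), line `saturated-sign-cells` — stub `stub_cellCensus`

The CENSUS step of the line `saturated-sign-cells` of the crux
`IsogenyCertificates.XMapPeriodTransfer`: for a saturated source piece `K ⊆ {P > 0}` (a union of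
cells of the cell locus `L = {P > 0, W ≠ 0}` up to the finite set `{W = 0}`), all of whose cells are
mapped by the real x-map `R` injectively onto the unbounded component `U'` of `{P' > 0}` or onto the
egg `E'`, and for which the rule-(2) move `[cell, a/√P] ≡ [R(cell), (a/|c|)/√P']` is available
(hypothesis), one has

  `[K, a/√P] ≡ [U', (m_U a/|c|)/√P'] + [E', (m_E a/|c|)/√P']`  (mod `KZ.relations`),

where `m_U`, `m_E` count the cells of `K` landing on `U'`, resp. `E'` (`m_E = 0` if all land on `U'`).
This is purely formal bookkeeping in the free abelian group of the Kontsevich–Zagier calculus: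
iterated domain additivity over the finite almost-partition of `K` into cells
(`KZ.of_sub_sum_of_mem_relations`), the per-cell moves, regrouping of the finite sum by target, and
merging `m` copies of `[D, q/√P']` into `[D, (m q)/√P']` by integrand additivity. The only
non-formal inputs are: connected components of `ℚ`-semialgebraic sets are `ℚ`-semialgebraic and
finite in number [Basu–Pollack–Roy 2006, Thm. 5.22], transported along `ℝ¹ ≃ₜ ℝ`, and "finite sets
are Lebesgue-null" — all from the line's basic-API file
`IsogenyCertificatesXMapPeriodTransferCellsBasic`.

References: M. Kontsevich, D. Zagier, *Periods* (2001), §1.2 (rules (1), (2)); S. Basu, R. Pollack,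
M.-F. Roy, *Algorithms in Real Algebraic Geometry* (2006), Thm. 5.22.
-/

noncomputable section

open Set Filter MeasureTheory Polynomial Topology
open Literature.NumberTheory.Transcendental
open Literature.ModelTheory.ExponentialFields (IsSemialgebraic)

namespace Summit.KontsevichZagierPeriods.IsogenyCertificates.XMapPeriodTransferCells

/-! ### Formal bookkeeping in `KZ.FormalRep` -/

/-- Merging copies by integrand additivity: for a family of representations `T q = [D, q/ψ]`
(`q : ℚ`) on a common domain, `m • [T q] − [T (m q)] ∈ KZ.relations` for every `m : ℕ`
(induction on `m`, one `KZ.integrandAddRel` instance per step; `[T 0]` is a relation since its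
integrand vanishes). [Kontsevich–Zagier 2001, §1.2, rule (1)] -/
theorem cellCensus_merge {n : ℕ} {D : Set (Fin n → ℝ)} {ψ : (Fin n → ℝ) → ℝ}
    (T : ℚ → KZ.IntegralRep n) (hTd : ∀ q, (T q).domain = D)
    (hTi : ∀ q, (T q).integrand = fun x => (q : ℝ) / ψ x) (q : ℚ) :
    ∀ m : ℕ, m • KZ.of (T q) - KZ.of (T (m * q)) ∈ KZ.relations
  | 0 => by
      have h : KZ.of (T (((0 : ℕ) : ℚ) * q)) ∈ KZ.relations :=
        KZ.of_mem_relations_of_eqOn_zero _ fun x _ => by simp [hTi]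
      simpa using KZ.relations.neg_mem h
  | m + 1 => by
      have ih := cellCensus_merge T hTd hTi q m
      have hadd : KZ.of (T ((m + 1 : ℕ) * q)) - KZ.of (T (m * q)) - KZ.of (T q) ∈ KZ.relations :=
        KZ.integrandAddRel_subset_relations ⟨n, T _, T _, T _, by rw [hTd, hTd], by rw [hTd, hTd],
          fun x _ => by simp only [hTi, Pi.add_apply]; push_cast; ring, rfl⟩
      have : (m + 1) • KZ.of (T q) - KZ.of (T ((m + 1 : ℕ) * q)) =
          (m • KZ.of (T q) - KZ.of (T (m * q))) -
            (KZ.of (T ((m + 1 : ℕ) * q)) - KZ.of (T (m * q)) - KZ.of (T q)) := by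
        rw [succ_nsmul]; abel
      rw [this]
      exact KZ.relations.sub_mem ih hadd

/-- The representations `[D, s/√P]` (`s : ℚ`) on a `ℚ`-semialgebraic `D ⊆ {P > 0}`, integrability
being inherited from that of `dx/√P` on `{P > 0}`. [Kontsevich–Zagier 2001, §1.1] -/
theorem cellCensus_exists_rep (A B : ℤ) {D : Set (Fin 1 → ℝ)} (hD : IsSemialgebraic ℚ D)
    (hDS : D ⊆ {x : Fin 1 → ℝ | 0 < x 0 ^ 3 + (A : ℝ) * x 0 + (B : ℝ)})
    (hint : IntegrableOn (fun x : Fin 1 → ℝ => 1 / Real.sqrt (x 0 ^ 3 + (A : ℝ) * x 0 + (B : ℝ)))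
      {x : Fin 1 → ℝ | 0 < x 0 ^ 3 + (A : ℝ) * x 0 + (B : ℝ)}) :
    ∃ T : ℚ → KZ.IntegralRep 1, (∀ s, (T s).domain = D) ∧
      ∀ s, (T s).integrand = fun x => (s : ℝ) / Real.sqrt (x 0 ^ 3 + (A : ℝ) * x 0 + (B : ℝ)) := by
  have hmeas : MeasurableSet D := IsSemialgebraic.measurableSet_holds hD
  refine ⟨fun s => ⟨D, fun x => (s : ℝ) / Real.sqrt (x 0 ^ 3 + (A : ℝ) * x 0 + (B : ℝ)), hD,
    (XMapPeriodTransferValue.isSemialgebraicFunOn_integrand A B s).mono hDS hD, ?_⟩,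
    fun _ => rfl, fun _ => rfl⟩
  have h1 : IntegrableOn
      (fun x : Fin 1 → ℝ => (s : ℝ) * (1 / Real.sqrt (x 0 ^ 3 + (A : ℝ) * x 0 + (B : ℝ)))) D :=
    (hint.mono_set hDS).const_mul (s : ℝ)
  exact h1.congr_fun (fun x _ => by ring) hmeas

/-- **Registered stub `stub_cellCensus`** (census = finite domain additivity + grouping +
integrand merges). For a saturated source piece `K ⊆ {P > 0}` all of whose cells are mapped
injectively onto `U'` or the egg `E'` and moved by rule (2):
`[K, a/√P] ≡ [U', (m_U a/|c|)/√P'] + [E', (m_E a/|c|)/√P']`, with `m_E = 0` when every cell lands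
on `U'`. [Kontsevich–Zagier 2001, §1.2, rules (1), (2)] -/
theorem stub_cellCensus : ∀ (A B A' B' : ℤ) (f g : ℚ[X]) (c : ℚ),
    derivative f * g - f * derivative g ≠ 0 →
    C (c ^ 2) * g * (f ^ 3 + C (A' : ℚ) * f * g ^ 2 + C (B' : ℚ) * g ^ 3) =
      (X ^ 3 + C (A : ℚ) * X + C (B : ℚ)) * (derivative f * g - f * derivative g) ^ 2 →
    ∀ (R W : ℝ → ℝ) (L : Set ℝ), R = (fun y => aeval y f / aeval y g) →
      W = (fun y => aeval y (derivative f * g - f * derivative g)) →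
      L = {y : ℝ | 0 < y ^ 3 + (A : ℝ) * y + (B : ℝ) ∧ W y ≠ 0} →
    ∀ (U' E' : Set ℝ), U' = connectedComponentIn {y : ℝ | 0 < y ^ 3 + (A' : ℝ) * y + (B' : ℝ)}
        (1 + |(A' : ℝ)| + |(B' : ℝ)|) →
      E' = {y : ℝ | 0 < y ^ 3 + (A' : ℝ) * y + (B' : ℝ)} \ U' →
    ∀ (K : Set ℝ), K ⊆ {y : ℝ | 0 < y ^ 3 + (A : ℝ) * y + (B : ℝ)} →
      IsSemialgebraic ℚ {x : Fin 1 → ℝ | x 0 ∈ K} →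
      (∀ x₀ ∈ L, x₀ ∈ K → connectedComponentIn L x₀ ⊆ K) →
      (∀ x₀ ∈ L, x₀ ∈ K → InjOn R (connectedComponentIn L x₀) ∧
        (R '' connectedComponentIn L x₀ = U' ∨ R '' connectedComponentIn L x₀ = E')) →
      (∀ x₀ ∈ L, x₀ ∈ K → ∀ (a : ℚ) (rI t : KZ.IntegralRep 1),
          rI.domain = {x | x 0 ∈ connectedComponentIn L x₀} →
          EqOn rI.integrand (fun x => (a : ℝ) / Real.sqrt (x 0 ^ 3 + (A : ℝ) * x 0 + (B : ℝ)))
            rI.domain →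
          t.domain = {x | x 0 ∈ R '' connectedComponentIn L x₀} →
          EqOn t.integrand
            (fun x => ((a / |c| : ℚ) : ℝ) / Real.sqrt (x 0 ^ 3 + (A' : ℝ) * x 0 + (B' : ℝ)))
            t.domain →
          KZ.of rI - KZ.of t ∈ KZ.relations) →
      IntegrableOn (fun x : Fin 1 → ℝ => 1 / Real.sqrt (x 0 ^ 3 + (A' : ℝ) * x 0 + (B' : ℝ)))
        {x : Fin 1 → ℝ | 0 < x 0 ^ 3 + (A' : ℝ) * x 0 + (B' : ℝ)} →
      ∃ mU mE : ℕ,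
        ((∀ x₀ ∈ L, x₀ ∈ K → R '' connectedComponentIn L x₀ = U') → mE = 0) ∧
        ∀ (a : ℚ) (ρ : KZ.IntegralRep 1), ρ.domain = {x | x 0 ∈ K} →
          EqOn ρ.integrand (fun x => (a : ℝ) / Real.sqrt (x 0 ^ 3 + (A : ℝ) * x 0 + (B : ℝ)))
            ρ.domain →
          ∃ u e : KZ.IntegralRep 1,
            u.domain = {x | x 0 ∈ U'} ∧
            EqOn u.integrand
              (fun x => ((mU * a / |c| : ℚ) : ℝ) / Real.sqrt (x 0 ^ 3 + (A' : ℝ) * x 0 + (B' : ℝ)))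
              u.domain ∧
            e.domain = {x | x 0 ∈ E'} ∧
            EqOn e.integrand
              (fun x => ((mE * a / |c| : ℚ) : ℝ) / Real.sqrt (x 0 ^ 3 + (A' : ℝ) * x 0 + (B' : ℝ)))
              e.domain ∧
            KZ.of ρ - KZ.of u - KZ.of e ∈ KZ.relations := by
  intro A B A' B' f g c hW _ R W L _ hWd hL U' E' hU' hE' K hK _ hsat himg hmove hint
  classical
  -- the `ℝ¹`-trace of the cell locus is `ℚ`-semialgebraic
  have hLsa : IsSemialgebraic ℚ {x : Fin 1 → ℝ | x 0 ∈ L} := by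
    rw [hL, hWd]; exact isSemialgebraic_hat_cellLocus A B f g
  -- the zero set of the Wronskian is finite
  have hZfin : {y : ℝ | W y = 0}.Finite := by
    refine ((derivative f * g - f * derivative g).aroots ℝ).toFinset.finite_toSet.subset
      fun y hy => ?_
    have hy' : aeval y (derivative f * g - f * derivative g) = 0 := by simpa [hWd] using hy
    exact Finset.mem_coe.mpr (Multiset.mem_toFinset.mpr (Polynomial.mem_aroots.mpr ⟨hW, hy'⟩))
  -- the cells of `K`: a finite set of connected components of `L`
  have h𝒞₀fin : {C : Set ℝ | ∃ y ∈ L, y ∈ K ∧ C = connectedComponentIn L y}.Finite :=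
    (finite_setOf_connectedComponentIn hLsa).subset fun C ⟨y, hyL, _, hC⟩ => ⟨y, hyL, hC⟩
  obtain ⟨𝒞, h𝒞⟩ : ∃ 𝒞 : Finset (Set ℝ), ∀ C, C ∈ 𝒞 ↔ ∃ y ∈ L, y ∈ K ∧ C = connectedComponentIn L y :=
    ⟨h𝒞₀fin.toFinset, fun C => h𝒞₀fin.mem_toFinset⟩
  have hspec : ∀ i : ↥𝒞, ∃ y ∈ L, y ∈ K ∧ (i : Set ℝ) = connectedComponentIn L y := fun i =>
    (h𝒞 _).mp i.2
  have hsa : ∀ i : ↥𝒞, IsSemialgebraic ℚ {x : Fin 1 → ℝ | x 0 ∈ (i : Set ℝ)} := fun i => by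
    obtain ⟨y, -, -, h⟩ := hspec i
    rw [h]; exact isSemialgebraic_hat_connectedComponentIn hLsa y
  have hsubK : ∀ i : ↥𝒞, (i : Set ℝ) ⊆ K := fun i => by
    obtain ⟨y, hyL, hyK, h⟩ := hspec i
    rw [h]; exact hsat y hyL hyK
  -- the target families `[Û', s/√P']`, `[Ê', s/√P']`
  have hU'sub : {x : Fin 1 → ℝ | x 0 ∈ U'} ⊆ {x | 0 < x 0 ^ 3 + (A' : ℝ) * x 0 + (B' : ℝ)} := by
    intro x hx
    have hx' : x 0 ∈ U' := hx
    rw [hU'] at hx'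
    have h := connectedComponentIn_subset _ _ hx'
    exact h
  have hE'sub : {x : Fin 1 → ℝ | x 0 ∈ E'} ⊆ {x | 0 < x 0 ^ 3 + (A' : ℝ) * x 0 + (B' : ℝ)} := by
    intro x hx
    have hx' : x 0 ∈ E' := hx
    rw [hE'] at hx'
    have h := hx'.1
    exact h
  have hPsa := XMapPeriodTransferValue.isSemialgebraic_setOf_cubic_pos A' B'
  have hU'sa : IsSemialgebraic ℚ {x : Fin 1 → ℝ | x 0 ∈ U'} := by
    rw [hU']; exact isSemialgebraic_hat_connectedComponentIn hPsa _
  have hE'sa : IsSemialgebraic ℚ {x : Fin 1 → ℝ | x 0 ∈ E'} := by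
    rw [hE']; exact hPsa.diff hU'sa
  obtain ⟨TU, hTUd, hTUi⟩ := cellCensus_exists_rep A' B' hU'sa hU'sub hint
  obtain ⟨TE, hTEd, hTEi⟩ := cellCensus_exists_rep A' B' hE'sa hE'sub hint
  -- the counts
  obtain ⟨mU, hmU⟩ : ∃ m : ℕ, (𝒞.attach.filter fun i : ↥𝒞 => R '' i.1 = U').card = m := ⟨_, rfl⟩
  obtain ⟨mE, hmE⟩ : ∃ m : ℕ, (𝒞.attach.filter fun i : ↥𝒞 => ¬ R '' i.1 = U').card = m :=
    ⟨_, rfl⟩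
  refine ⟨mU, mE, fun hall => ?_, fun a ρ hρd hρe => ?_⟩
  · rw [← hmE, Finset.card_eq_zero, Finset.filter_eq_empty_iff]
    intro i _ h
    obtain ⟨y, hyL, hyK, hC⟩ := hspec i
    exact h (by rw [hC]; exact hall y hyL hyK)
  -- the cell pieces `ρ_ i = [Ĉᵢ, a/√P]`
  have hsub : ∀ i : ↥𝒞, {x : Fin 1 → ℝ | x 0 ∈ (i : Set ℝ)} ⊆ ρ.domain := fun i x hx => by
    rw [hρd]; exact hsubK i hx
  obtain ⟨ρ_, hρ_d, hρ_i⟩ : ∃ ρ_ : ↥𝒞 → KZ.IntegralRep 1,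
      (∀ i, (ρ_ i).domain = {x : Fin 1 → ℝ | x 0 ∈ (i : Set ℝ)}) ∧
        ∀ i, (ρ_ i).integrand = ρ.integrand :=
    ⟨fun i => ρ.restrict _ (hsa i) (hsub i), fun _ => rfl, fun _ => rfl⟩
  -- (a) `[ρ] − ∑ᵢ [ρ_ i] ∈ relations`: finite domain additivity
  have hcover : ρ.domain \ (⋃ i ∈ 𝒞.attach, (ρ_ i).domain) ⊆
      {x : Fin 1 → ℝ | x 0 ∈ {y : ℝ | W y = 0}} := by
    rintro x ⟨hxK, hxU⟩
    rw [hρd] at hxK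
    by_contra hWx
    have hxL : x 0 ∈ L := by rw [hL]; exact ⟨hK hxK, hWx⟩
    have hmem : connectedComponentIn L (x 0) ∈ 𝒞 := (h𝒞 _).mpr ⟨x 0, hxL, hxK, rfl⟩
    exact hxU (Set.mem_iUnion₂.mpr ⟨⟨_, hmem⟩, Finset.mem_attach _ _, by
      rw [hρ_d]; exact mem_connectedComponentIn hxL⟩)
  have hdisj : ∀ i j : ↥𝒞, i ≠ j → (ρ_ i).domain ∩ (ρ_ j).domain = ∅ := by
    intro i j hij
    obtain ⟨y, -, -, hi⟩ := hspec i
    obtain ⟨y', -, -, hj⟩ := hspec j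
    refine Set.eq_empty_of_forall_notMem fun x hx => hij (Subtype.ext ?_)
    rw [hρ_d, hρ_d] at hx
    have hx1 : x 0 ∈ connectedComponentIn L y := by rw [← hi]; exact hx.1
    have hx2 : x 0 ∈ connectedComponentIn L y' := by rw [← hj]; exact hx.2
    rw [hi, hj, connectedComponentIn_eq hx1, connectedComponentIn_eq hx2]
  have h1 : KZ.of ρ - ∑ i ∈ 𝒞.attach, KZ.of (ρ_ i) ∈ KZ.relations := by
    refine KZ.of_sub_sum_of_mem_relations 𝒞.attach ρ ρ_ (fun i _ => ?_)
      (fun i _ x _ => by rw [hρ_i]) ?_ ?_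
    · rw [hρ_d, Set.sdiff_eq_empty.mpr (hsub i), measure_empty]
    · exact measure_mono_null hcover (volume_hat_eq_zero_of_finite hZfin)
    · intro i _ j _ hij
      rw [hdisj i j hij, measure_empty]
  -- (b) the per-cell moves `[ρ_ i] − [t i] ∈ relations`
  obtain ⟨t, htU, htE⟩ : ∃ t : ↥𝒞 → KZ.IntegralRep 1,
      (∀ i : ↥𝒞, R '' i.1 = U' → t i = TU (a / |c|)) ∧
        ∀ i : ↥𝒞, ¬ R '' i.1 = U' → t i = TE (a / |c|) :=
    ⟨fun i => if R '' i.1 = U' then TU (a / |c|) else TE (a / |c|), fun i h => if_pos h,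
      fun i h => if_neg h⟩
  have h2 : ∑ i ∈ 𝒞.attach, KZ.of (ρ_ i) - ∑ i ∈ 𝒞.attach, KZ.of (t i) ∈ KZ.relations := by
    refine KZ.sum_sub_sum_mem_relations _ _ _ fun i _ => ?_
    obtain ⟨y, hyL, hyK, hC⟩ := hspec i
    obtain ⟨-, hUE⟩ := himg y hyL hyK
    refine hmove y hyL hyK a (ρ_ i) (t i) (by rw [hρ_d, hC]) (fun x hx => ?_) ?_ ?_
    · rw [hρ_i]
      rw [hρ_d] at hx
      exact hρe (hsub i hx)
    · by_cases hU : R '' i.1 = U'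
      · rw [htU i hU, hTUd, ← hC, hU]
      · rcases hUE with h | h
        · exact absurd (by rw [hC, h]) hU
        · rw [htE i hU, hTEd, h]
    · intro x _
      by_cases hU : R '' i.1 = U'
      · rw [htU i hU, hTUi]
      · rw [htE i hU, hTEi]
  -- (c) regrouping by target
  have hsum : ∑ i ∈ 𝒞.attach, KZ.of (t i) =
      mU • KZ.of (TU (a / |c|)) + mE • KZ.of (TE (a / |c|)) := by
    rw [← Finset.sum_filter_add_sum_filter_not 𝒞.attach (fun i : ↥𝒞 => R '' i.1 = U'),
      Finset.sum_congr rfl fun i hi => by rw [htU i (Finset.mem_filter.mp hi).2], Finset.sum_const,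
      Finset.sum_congr rfl fun i hi => by rw [htE i (Finset.mem_filter.mp hi).2], Finset.sum_const,
      hmU, hmE]
  -- (d) merging the copies
  have h3 := cellCensus_merge TU hTUd hTUi (a / |c|) mU
  have h4 := cellCensus_merge TE hTEd hTEi (a / |c|) mE
  rw [← mul_div_assoc] at h3 h4
  refine ⟨TU (mU * a / |c|), TE (mE * a / |c|), hTUd _, fun x _ => by rw [hTUi], hTEd _,
    fun x _ => by rw [hTEi], ?_⟩
  have key := KZ.relations.add_mem (KZ.relations.add_mem (KZ.relations.add_mem h1 h2) h3) h4
  rw [hsum] at key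
  convert key using 1
  abel

end Summit.KontsevichZagierPeriods.IsogenyCertificates.XMapPeriodTransferCells

end
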